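import Literature.Geometry.Kaehler.ComplexTorusQuotientHodgeGroupProjection
import HarnessLib

/-!
# `Hg(X)(ℂ) ≅ Hg(Y × X/Y)(ℂ)` by `g ↦ diag(g_Y, g_{X/Y})`: the restriction to an abelian subvariety and the descent to
# the quotient TOGETHER identify the Hodge group of `X` with the Hodge group of `Y × X/Y`, complex points
# (Moonen–Zarhin (3.1) "`Hg(X₁ × X₂)` is an algebraic subgroup of `Hg(X₁) × Hg(X₂)`" + (0.2)(4) for `X ∼ Y × X/Y`)

Layer `Literature/Geometry/Kaehler`, namespace `Literature.Geometry.Kaehler.ComplexTorus`; lane `lit-hodgefound`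
(Track 2 foundations library), Layer A3/A4; prover seat `lit-hodgefound-p36` (generation 14, self-proposed row
g14-#7; sequel of g14-#2 `ComplexTorusSubtorusHodgeGroupRestriction` (`g ι_V = ι_V g_Y`, `g_Y ∈ Hg(Y)(ℂ)`), g14-#3
`ComplexTorusQuotientHodgeGroupProjection` (`Q_V g = g_{X/Y} Q_V`, `g_{X/Y} ∈ Hg(X/Y)(ℂ)`) and g14-#5
`ComplexTorusHomomorphismImageHodgeGroup` §1 (`g ↦ (g_Y, g_{X/Y})` is injective, BY NAME, not imported)).
THEOREMS ONLY (no definition, no named fact, net debt 0). Ingredients BY NAME: the addition isogeny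
`A = (ι_V | ι_W) : Y × Z → X` (`isIsogeny_addition`), the isogeny `C = Q_V ι_W : Z → X/Y`
(`isIsogeny_subtorus_quotient_of_isCompl`), `IsIsogeny.prod`, `isIsogeny_one`, p40's transport
`mem_hodgeGroupC_iff_of_homRat` and product structure `exists_eq_blockDiagC_of_mem_hodgeGroupC_prod`, `blockDiagC`.

## Sources, verbatim

* B. Moonen, Yu. Zarhin, *Hodge classes on abelian varieties of low dimension*, Math. Ann. 315 (1999), §3 (3.1)
  (held `paper:arxiv-math_9901113` p0006 L25–L28): "Let `X₁` and `X₂` be complex abelian varieties. Write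
  `X = X₁ × X₂`. Then `Hg(X)` is an algebraic subgroup of `Hg(X₁) × Hg(X₂)`. The two projections
  `prᵢ : Hg(X) → Hg(Xᵢ)` are surjective."; (0.2)(4): the Hodge group depends on `X` up to isogeny only.
* H. Lange, *Abelian Varieties over the Complex Numbers* (2023), §2.4.4 Thm. 2.4.23 / Cor. 2.4.24 (`X ∼ Y × Z`,
  `Z → X/Y` an isogeny; Poincaré), §1.4.1 Prop. 1.4.2, §7.2.1.
* M. Green, P. Griffiths, M. Kerr, *Mumford–Tate Groups and Domains* (2012), §I.B (I.B.7) (p. 40): "Given a morphism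
  `σ : V_φ̃ → V′_φ̃′` of Hodge structures … we have surjective maps `M_φ̃ ↠ M_{σ(φ̃)} ↞ M_{φ′}`."

## What is proved (complex points; `Y = π(ΦV)`, `Z = π(ΦW)` complementary, `X/Y = ComplexTorus (quotientTorusPeriod Φ V)`)

* §1 **`blockDiagC_mem_hodgeGroupC_subtorus_quotient`**: for `g ∈ Hg(X)(ℂ)` with restriction `g_Y` (`g ι_V = ι_V g_Y`)
  and descent `g_{X/Y}` (`Q_V g = g_{X/Y} Q_V`), **`diag(g_Y, g_{X/Y}) ∈ Hg(Y × X/Y)(ℂ)`** — transport of g14-#2's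
  `diag(g_Y, g_Z) ∈ Hg(Y × Z)(ℂ)` along the isogeny `1 × C : Y × Z → Y × X/Y`.
* §2 **`exists_mem_hodgeGroupC_of_blockDiagC_mem_subtorus_quotient`**: conversely every
  `diag(N_Y, N_Q) ∈ Hg(Y × X/Y)(ℂ)` is `diag(g_Y, g_{X/Y})` for some `g ∈ Hg(X)(ℂ)` (unique by g14-#5
  `eq_of_mul_subtorusMatrix_eq_of_quotientTorusMatrix_mul_eq`) — so **`g ↦ diag(g_Y, g_{X/Y})` is a bijection
  `Hg(X)(ℂ) ≅ Hg(Y × X/Y)(ℂ)`**, i.e. MZ99 (3.1) "`Hg(X) ⊂ Hg(X₁) × Hg(X₂)`" for the canonical isogeny factors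
  `X₁ = Y`, `X₂ = X/Y` of `X`, with the inclusion realised by restriction and descent;
  `mem_hodgeGroupC_prod_subtorus_quotient_iff` packages both directions.
* §3 the versions for an abelian subvariety of a polarised torus (`Z = Y^⊥`, Poincaré).

## References

* [MoonenZarhin1999LowDim] B. Moonen, Yu. Zarhin, Math. Ann. 315 (1999), (0.2)(4), §3 (3.1).
* [Lange2023AbelianVarietiesComplex] H. Lange, *Abelian Varieties over the Complex Numbers* (2023), §1.4.1
  Prop. 1.4.2, §2.4.4 Thm. 2.4.23, Cor. 2.4.24, §7.2.1.
* [GreenGriffithsKerr2012] M. Green, P. Griffiths, M. Kerr, *Mumford–Tate Groups and Domains* (2012), §I.B (I.B.7).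
-/

noncomputable section

open Module Matrix Function

namespace Literature.Geometry.Kaehler

namespace ComplexTorus

section Complementary

variable {ι : Type*} [Fintype ι] [DecidableEq ι] {E : Type*} [NormedAddCommGroup E] [NormedSpace ℂ E]
  (Φ : (ι → ℝ) ≃L[ℝ] E) {V W : Submodule ℝ (ι → ℝ)}

omit [Fintype ι] [DecidableEq ι] in
/-- `(A_ℚ)_ℂ = A_ℂ` for an integer matrix. [folklore] -/
private theorem map_map_algebraMap_eq₃ {m n : Type*} (A : Matrix m n ℤ) :
    (A.map (Int.cast : ℤ → ℚ)).map (algebraMap ℚ ℂ) = A.map (Int.cast : ℤ → ℂ) := by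
  ext i j
  simp

omit [Fintype ι] [DecidableEq ι] in
/-- `(M N)_ℂ = M_ℂ N_ℂ`. [folklore] -/
private theorem map_mul_intCast₃ {m n o : Type*} [Fintype n] (M : Matrix m n ℤ) (N : Matrix n o ℤ) :
    (M * N).map (Int.cast : ℤ → ℂ) = M.map (Int.cast : ℤ → ℂ) * N.map (Int.cast : ℤ → ℂ) :=
  Matrix.map_mul (f := Int.castRingHom ℂ)

omit [DecidableEq ι] in
/-- Column reading of `g · (ι_V | ι_W) = (ι_V | ι_W) · diag(g_Y, g_Z)`. [folklore] -/
private theorem mul_additionMatrix_eq_iff' {g : Matrix ι ι ℂ}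
    {gY : Matrix (Fin (subRank V)) (Fin (subRank V)) ℂ} {gZ : Matrix (Fin (subRank W)) (Fin (subRank W)) ℂ} :
    g * (additionMatrix V W).map (Int.cast : ℤ → ℂ) =
        (additionMatrix V W).map (Int.cast : ℤ → ℂ) * Matrix.fromBlocks gY 0 0 gZ ↔
      g * (subtorusMatrix V).map (Int.cast : ℤ → ℂ) = (subtorusMatrix V).map (Int.cast : ℤ → ℂ) * gY ∧
        g * (subtorusMatrix W).map (Int.cast : ℤ → ℂ) = (subtorusMatrix W).map (Int.cast : ℤ → ℂ) * gZ := by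
  rw [additionMatrix, Matrix.fromCols_map, Matrix.mul_fromCols, Matrix.fromCols_mul_fromBlocks, Matrix.mul_zero,
    Matrix.mul_zero, add_zero, zero_add, Matrix.fromCols_ext_iff]

/-- Right cancellation of `(ι_V | ι_W)_ℂ`. [cite: Lange2023AbelianVarietiesComplex, §2.4.4 Cor. 2.4.24] -/
private theorem eq_of_mul_additionMatrix_eq₃ {κ : Type*} (hV : IsLatticeSubspace V) (hVc : IsComplexSubspace Φ V)
    (hW : IsLatticeSubspace W) (hWc : IsComplexSubspace Φ W) (hc : IsCompl V W) {M M' : Matrix κ ι ℂ}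
    (h : M * (additionMatrix V W).map (Int.cast : ℤ → ℂ) = M' * (additionMatrix V W).map (Int.cast : ℤ → ℂ)) :
    M = M' := by
  obtain ⟨Q, -, -, hPQ⟩ := (isIsogeny_addition Φ hV hVc hW hWc hc).exists_homRat_inverse
  have hQ : (additionMatrix V W).map (Int.cast : ℤ → ℂ) * Q.map (algebraMap ℚ ℂ) = 1 := by
    rw [← map_map_algebraMap_eq₃, ← Matrix.map_mul, hPQ, Matrix.map_one (algebraMap ℚ ℂ) (map_zero _) (map_one _)]
  have := congrArg (fun N ↦ N * Q.map (algebraMap ℚ ℂ)) h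
  simpa only [Matrix.mul_assoc, hQ, Matrix.mul_one] using this

/-- The mechanism of g14-#3, restated privately with an arbitrary two-sided rational inverse `C′` of `C = Q_V ι_W`:
`g ι_V = ι_V g_Y`, `g ι_W = ι_W g_Z` ⟹ `Q_ℂ g = (C_ℂ g_Z C′_ℂ) Q_ℂ`. [cite: Lange2023AbelianVarietiesComplex, §1.4.1 Prop. 1.4.2, §2.4.4 Cor. 2.4.24] -/
private theorem quotientTorusMatrix_mul_eq_conj_mul (hV : IsLatticeSubspace V) (hVc : IsComplexSubspace Φ V)
    (hW : IsLatticeSubspace W) (hWc : IsComplexSubspace Φ W) (hc : IsCompl V W) {g : Matrix ι ι ℂ}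
    {gY : Matrix (Fin (subRank V)) (Fin (subRank V)) ℂ} {gZ : Matrix (Fin (subRank W)) (Fin (subRank W)) ℂ}
    (hY : g * (subtorusMatrix V).map (Int.cast : ℤ → ℂ) = (subtorusMatrix V).map (Int.cast : ℤ → ℂ) * gY)
    (hZ : g * (subtorusMatrix W).map (Int.cast : ℤ → ℂ) = (subtorusMatrix W).map (Int.cast : ℤ → ℂ) * gZ)
    {C' : Matrix (Fin (subRank W)) (QuotIndex V) ℚ}
    (hC' : C' * (quotientTorusMatrix V * subtorusMatrix W).map (Int.cast : ℤ → ℚ) = 1) :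
    (quotientTorusMatrix V).map (Int.cast : ℤ → ℂ) * g =
      ((quotientTorusMatrix V * subtorusMatrix W).map (Int.cast : ℤ → ℂ) * gZ * C'.map (algebraMap ℚ ℂ)) *
        (quotientTorusMatrix V).map (Int.cast : ℤ → ℂ) := by
  have hC : (quotientTorusMatrix V * subtorusMatrix W).map (Int.cast : ℤ → ℂ) =
      (quotientTorusMatrix V).map (Int.cast : ℤ → ℂ) * (subtorusMatrix W).map (Int.cast : ℤ → ℂ) :=
    map_mul_intCast₃ _ _
  have hC'C : C'.map (algebraMap ℚ ℂ) *
      ((quotientTorusMatrix V).map (Int.cast : ℤ → ℂ) * (subtorusMatrix W).map (Int.cast : ℤ → ℂ)) = 1 := by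
    rw [← hC, ← map_map_algebraMap_eq₃, ← Matrix.map_mul, hC', Matrix.map_one (algebraMap ℚ ℂ) (map_zero _) (map_one _)]
  have h0 : (quotientTorusMatrix V).map (Int.cast : ℤ → ℂ) * (subtorusMatrix V).map (Int.cast : ℤ → ℂ) = 0 := by
    rw [← map_mul_intCast₃, quotientTorusMatrix_mul_subtorusMatrix, Matrix.map_zero _ Int.cast_zero]
  refine eq_of_mul_additionMatrix_eq₃ Φ hV hVc hW hWc hc ?_
  rw [additionMatrix, Matrix.fromCols_map, Matrix.mul_assoc, Matrix.mul_fromCols, hY, hZ, Matrix.mul_fromCols,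
    ← Matrix.mul_assoc, ← Matrix.mul_assoc, h0, Matrix.zero_mul, Matrix.mul_assoc _ ((quotientTorusMatrix V).map _),
    Matrix.mul_fromCols, h0, Matrix.mul_fromCols, Matrix.mul_zero, Matrix.mul_assoc _ (C'.map _), hC'C, Matrix.mul_one,
    hC]

omit [DecidableEq ι] in
/-- Transport along the isogeny `1 × C : Y × Z → Y × X/Y` (`C = Q_V ι_W`): membership in `Hg(Y × X/Y)(ℂ)` read on
`Hg(Y × Z)(ℂ)`, with the conjugation computed blockwise. [cite: MoonenZarhin1999LowDim, (0.2)(4)]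
[cite: Lange2023AbelianVarietiesComplex, §2.4.4 Thm. 2.4.23 (the isogeny `Z → X/Y`)] -/
private theorem mem_hodgeGroupC_prod_quotient_iff_exists (hV : IsLatticeSubspace V) (hVc : IsComplexSubspace Φ V)
    (hW : IsLatticeSubspace W) (hWc : IsComplexSubspace Φ W) (hc : IsCompl V W)
    {C' : Matrix (Fin (subRank W)) (QuotIndex V) ℚ}
    (hC'C : C' * (quotientTorusMatrix V * subtorusMatrix W).map (Int.cast : ℤ → ℚ) = 1)
    (hCC' : (quotientTorusMatrix V * subtorusMatrix W).map (Int.cast : ℤ → ℚ) * C' = 1)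
    {N : SpecialLinearGroup (Fin (subRank V) ⊕ QuotIndex V) ℂ} :
    N ∈ hodgeGroupC (prodPeriod (subtorusPeriod Φ V hV hVc) (quotientTorusPeriod Φ V hV hVc)) ↔
      ∃ MY ∈ hodgeGroupC (subtorusPeriod Φ V hV hVc), ∃ MZ ∈ hodgeGroupC (subtorusPeriod Φ W hW hWc),
        blockDiagC _ _ (MY, MZ) ∈ hodgeGroupC (prodPeriod (subtorusPeriod Φ V hV hVc) (subtorusPeriod Φ W hW hWc)) ∧
        Matrix.fromBlocks MY.1 0 0
          ((quotientTorusMatrix V * subtorusMatrix W).map (Int.cast : ℤ → ℂ) * MZ.1 * C'.map (algebraMap ℚ ℂ)) = N.1 := by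
  have hB := IsIsogeny.prod (h₁ := isIsogeny_one (subtorusPeriod Φ V hV hVc))
    (h₂ := isIsogeny_subtorus_quotient_of_isCompl Φ hV hVc hW hWc hc)
  -- the rational inverse `B′ = 1 × C′` of `B = 1 × C`
  set B' : Matrix (Fin (subRank V) ⊕ Fin (subRank W)) (Fin (subRank V) ⊕ QuotIndex V) ℚ :=
    Matrix.fromBlocks 1 0 0 C' with hB'
  have hBq : (Matrix.fromBlocks (1 : Matrix (Fin (subRank V)) (Fin (subRank V)) ℤ) 0 0
      (quotientTorusMatrix V * subtorusMatrix W)).map (Int.cast : ℤ → ℚ) =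
      Matrix.fromBlocks 1 0 0 ((quotientTorusMatrix V * subtorusMatrix W).map (Int.cast : ℤ → ℚ)) := by
    rw [Matrix.fromBlocks_map, Matrix.map_one _ Int.cast_zero Int.cast_one, Matrix.map_zero _ Int.cast_zero,
      Matrix.map_zero _ Int.cast_zero]
  have hB'B : B' * (Matrix.fromBlocks (1 : Matrix (Fin (subRank V)) (Fin (subRank V)) ℤ) 0 0
      (quotientTorusMatrix V * subtorusMatrix W)).map (Int.cast : ℤ → ℚ) = 1 := by
    rw [hBq, hB', Matrix.fromBlocks_multiply]
    simp [hC'C]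
  have hBB' : (Matrix.fromBlocks (1 : Matrix (Fin (subRank V)) (Fin (subRank V)) ℤ) 0 0
      (quotientTorusMatrix V * subtorusMatrix W)).map (Int.cast : ℤ → ℚ) * B' = 1 := by
    rw [hBq, hB', Matrix.fromBlocks_multiply]
    simp [hCC']
  rw [mem_hodgeGroupC_iff_of_homRat hB.map_intCast_mem_homRat hB'B hBB']
  -- blockwise conjugation
  have hconj : ∀ (MY : Matrix (Fin (subRank V)) (Fin (subRank V)) ℂ) (MZ : Matrix (Fin (subRank W)) (Fin (subRank W)) ℂ),
      ((Matrix.fromBlocks (1 : Matrix (Fin (subRank V)) (Fin (subRank V)) ℤ) 0 0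
          (quotientTorusMatrix V * subtorusMatrix W)).map (Int.cast : ℤ → ℚ)).map (algebraMap ℚ ℂ) *
        Matrix.fromBlocks MY 0 0 MZ * B'.map (algebraMap ℚ ℂ) =
      Matrix.fromBlocks MY 0 0
        ((quotientTorusMatrix V * subtorusMatrix W).map (Int.cast : ℤ → ℂ) * MZ * C'.map (algebraMap ℚ ℂ)) := by
    intro MY MZ
    rw [map_map_algebraMap_eq₃, hB', Matrix.fromBlocks_map, Matrix.fromBlocks_map, Matrix.fromBlocks_multiply,
      Matrix.fromBlocks_multiply]
    simp [Matrix.map_one _ Int.cast_zero Int.cast_one, Matrix.map_zero _ Int.cast_zero,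
      Matrix.map_one (algebraMap ℚ ℂ) (map_zero _) (map_one _), Matrix.map_zero (algebraMap ℚ ℂ) (map_zero _)]
  constructor
  · rintro ⟨M, hM, hMN⟩
    obtain ⟨MY, hMY, MZ, hMZ, rfl⟩ := exists_eq_blockDiagC_of_mem_hodgeGroupC_prod _ _ hM
    refine ⟨MY, hMY, MZ, hMZ, hM, ?_⟩
    rw [← hMN, coe_blockDiagC, hconj]
  · rintro ⟨MY, -, MZ, -, hM, hMN⟩
    refine ⟨_, hM, ?_⟩
    rw [coe_blockDiagC, hconj, hMN]

/-! ## §1 `diag(g_Y, g_{X/Y}) ∈ Hg(Y × X/Y)(ℂ)` -/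

/-- **MZ99 (3.1) for the canonical isogeny factors `Y`, `X/Y` of `X`, complex points: the pair (restriction,
descent) of an element of `Hg(X)(ℂ)` lies in `Hg(Y × X/Y)(ℂ)`.** For complementary abelian subvarieties
`Y = π(ΦV)`, `Z = π(ΦW)`, `g ∈ Hg(X)(ℂ)`, and `g_Y`, `g_{X/Y}` with `g ι_V = ι_V g_Y` (g14-#2) and
`Q_V g = g_{X/Y} Q_V` (g14-#3): **`diag(g_Y, g_{X/Y}) ∈ Hg(Y × X/Y)(ℂ)`** — the transport of g14-#2's
`diag(g_Y, g_Z) ∈ Hg(Y × Z)(ℂ)` along the isogeny `1 × (Q_V ι_W) : Y × Z → Y × X/Y`, `g_{X/Y} = C g_Z C⁻¹`.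
[cite: MoonenZarhin1999LowDim, §3 (3.1) and (0.2)(4)] [cite: Lange2023AbelianVarietiesComplex, §2.4.4 Thm. 2.4.23, Cor. 2.4.24]
[cite: GreenGriffithsKerr2012, §I.B (I.B.7) (p. 40)] -/
theorem blockDiagC_mem_hodgeGroupC_subtorus_quotient (hV : IsLatticeSubspace V) (hVc : IsComplexSubspace Φ V)
    (hW : IsLatticeSubspace W) (hWc : IsComplexSubspace Φ W) (hc : IsCompl V W) {g : SpecialLinearGroup ι ℂ}
    (hg : g ∈ hodgeGroupC Φ) {gY : SpecialLinearGroup (Fin (subRank V)) ℂ} {gQ : SpecialLinearGroup (QuotIndex V) ℂ}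
    (hY : g.1 * (subtorusMatrix V).map (Int.cast : ℤ → ℂ) = (subtorusMatrix V).map (Int.cast : ℤ → ℂ) * gY.1)
    (hQ : (quotientTorusMatrix V).map (Int.cast : ℤ → ℂ) * g.1 = gQ.1 * (quotientTorusMatrix V).map (Int.cast : ℤ → ℂ)) :
    blockDiagC _ _ (gY, gQ) ∈ hodgeGroupC (prodPeriod (subtorusPeriod Φ V hV hVc) (quotientTorusPeriod Φ V hV hVc)) := by
  obtain ⟨C', -, hC'C, hCC'⟩ := (isIsogeny_subtorus_quotient_of_isCompl Φ hV hVc hW hWc hc).exists_homRat_inverse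
  obtain ⟨gY', gZ, hM, hA⟩ := exists_blockDiagC_of_mem_hodgeGroupC Φ hV hVc hW hWc hc hg
  obtain ⟨hY', hZ⟩ := mul_additionMatrix_eq_iff'.1 hA
  have hYY : gY'.1 = gY.1 := eq_of_subtorusMatrix_mul_eq Φ hV hVc hW hWc hc (hY'.symm.trans hY)
  -- `g_{X/Y} = C g_Z C′` by uniqueness of the descent
  have hQQ : (quotientTorusMatrix V * subtorusMatrix W).map (Int.cast : ℤ → ℂ) * gZ.1 * C'.map (algebraMap ℚ ℂ) = gQ.1 :=
    eq_of_mul_quotientTorusMatrix_eq V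
      ((quotientTorusMatrix_mul_eq_conj_mul Φ hV hVc hW hWc hc hY' hZ hC'C).symm.trans hQ)
  refine (mem_hodgeGroupC_prod_quotient_iff_exists Φ hV hVc hW hWc hc hC'C hCC').2
    ⟨gY', fst_mem_hodgeGroupC_of_blockDiagC_mem _ _ hM, gZ, snd_mem_hodgeGroupC_of_blockDiagC_mem _ _ hM, hM, ?_⟩
  rw [coe_blockDiagC, hYY, hQQ]

/-! ## §2 Conversely: every element of `Hg(Y × X/Y)(ℂ)` is `diag(g_Y, g_{X/Y})` for some `g ∈ Hg(X)(ℂ)` -/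

/-- **Every `diag(N_Y, N_Q) ∈ Hg(Y × X/Y)(ℂ)` is the (restriction, descent) pair of an element of `Hg(X)(ℂ)`**: there
is `g ∈ Hg(X)(ℂ)` with `g ι_V = ι_V N_Y` and `Q_V g = N_Q Q_V` (unique by g14-#5
`eq_of_mul_subtorusMatrix_eq_of_quotientTorusMatrix_mul_eq`). Hence **`g ↦ diag(g_Y, g_{X/Y})` is a bijection
`Hg(X)(ℂ) ≅ Hg(Y × X/Y)(ℂ)`** — MZ99 (3.1) "`Hg(X) ⊂ Hg(X₁) × Hg(X₂)`" realised by restriction and descent for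
`X ∼ Y × X/Y`. Proof: transport `1 × C` back to `Hg(Y × Z)(ℂ)`, then the addition isogeny `(ι_V | ι_W)` to `Hg(X)(ℂ)`.
[cite: MoonenZarhin1999LowDim, §3 (3.1) and (0.2)(4)] [cite: Lange2023AbelianVarietiesComplex, §2.4.4 Thm. 2.4.23, Cor. 2.4.24]
[cite: GreenGriffithsKerr2012, §I.B (I.B.7) (p. 40)] -/
theorem exists_mem_hodgeGroupC_of_blockDiagC_mem_subtorus_quotient (hV : IsLatticeSubspace V)
    (hVc : IsComplexSubspace Φ V) (hW : IsLatticeSubspace W) (hWc : IsComplexSubspace Φ W) (hc : IsCompl V W)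
    {NY : SpecialLinearGroup (Fin (subRank V)) ℂ} {NQ : SpecialLinearGroup (QuotIndex V) ℂ}
    (hN : blockDiagC _ _ (NY, NQ) ∈ hodgeGroupC (prodPeriod (subtorusPeriod Φ V hV hVc) (quotientTorusPeriod Φ V hV hVc))) :
    ∃ g ∈ hodgeGroupC Φ,
      g.1 * (subtorusMatrix V).map (Int.cast : ℤ → ℂ) = (subtorusMatrix V).map (Int.cast : ℤ → ℂ) * NY.1 ∧
        (quotientTorusMatrix V).map (Int.cast : ℤ → ℂ) * g.1 = NQ.1 * (quotientTorusMatrix V).map (Int.cast : ℤ → ℂ) := by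
  obtain ⟨C', -, hC'C, hCC'⟩ := (isIsogeny_subtorus_quotient_of_isCompl Φ hV hVc hW hWc hc).exists_homRat_inverse
  obtain ⟨MY, -, MZ, -, hM, hMN⟩ :=
    (mem_hodgeGroupC_prod_quotient_iff_exists Φ hV hVc hW hWc hc hC'C hCC').1 hN
  rw [coe_blockDiagC] at hMN
  obtain ⟨hYN, -, -, hQN⟩ := Matrix.fromBlocks_inj.1 hMN
  -- `g = A diag(M_Y, M_Z) A⁻¹ ∈ Hg(X)(ℂ)` along the addition isogeny
  have hA := isIsogeny_addition Φ hV hVc hW hWc hc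
  obtain ⟨A', -, hA'A, hAA'⟩ := hA.exists_homRat_inverse
  have hA'A' : A'.map (algebraMap ℚ ℂ) * ((additionMatrix V W).map (Int.cast : ℤ → ℚ)).map (algebraMap ℚ ℂ) = 1 := by
    rw [← Matrix.map_mul, hA'A, Matrix.map_one (algebraMap ℚ ℂ) (map_zero _) (map_one _)]
  have hAA'' : ((additionMatrix V W).map (Int.cast : ℤ → ℚ)).map (algebraMap ℚ ℂ) * A'.map (algebraMap ℚ ℂ) = 1 := by
    rw [← Matrix.map_mul, hAA', Matrix.map_one (algebraMap ℚ ℂ) (map_zero _) (map_one _)]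
  set gm : Matrix ι ι ℂ := ((additionMatrix V W).map (Int.cast : ℤ → ℚ)).map (algebraMap ℚ ℂ) *
    (blockDiagC _ _ (MY, MZ)).1 * A'.map (algebraMap ℚ ℂ) with hgm
  have hdet : gm.det = 1 := by
    rw [hgm, Matrix.mul_assoc, Matrix.det_comm' hAA'' hA'A', Matrix.mul_assoc, hA'A', Matrix.mul_one]
    exact (blockDiagC _ _ (MY, MZ)).2
  have hg : (⟨gm, hdet⟩ : SpecialLinearGroup ι ℂ) ∈ hodgeGroupC Φ :=
    (mem_hodgeGroupC_iff_of_homRat hA.map_intCast_mem_homRat hA'A hAA').2 ⟨_, hM, rfl⟩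
  -- its blocks: `g A = A diag(M_Y, M_Z)`
  have hgA : gm * (additionMatrix V W).map (Int.cast : ℤ → ℂ) =
      (additionMatrix V W).map (Int.cast : ℤ → ℂ) * Matrix.fromBlocks MY.1 0 0 MZ.1 := by
    rw [hgm, ← map_map_algebraMap_eq₃, Matrix.mul_assoc, Matrix.mul_assoc, hA'A', Matrix.mul_one, coe_blockDiagC]
  obtain ⟨hY, hZ⟩ := mul_additionMatrix_eq_iff'.1 hgA
  refine ⟨⟨gm, hdet⟩, hg, ?_, ?_⟩
  · rw [← hYN]
    exact hY
  · rw [← hQN]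
    exact quotientTorusMatrix_mul_eq_conj_mul Φ hV hVc hW hWc hc hY hZ hC'C

/-- **`Hg(Y × X/Y)(ℂ) = {diag(g_Y, g_{X/Y}) : g ∈ Hg(X)(ℂ)}`** — both directions packaged: an element of
`SL(H₁(Y) ⊕ H₁(X/Y)) ⊗ ℂ` lies in `Hg(Y × X/Y)(ℂ)` iff it is the block-diagonal pair (restriction, descent) of some
`g ∈ Hg(X)(ℂ)`. [cite: MoonenZarhin1999LowDim, §3 (3.1) and (0.2)(4)] [cite: Lange2023AbelianVarietiesComplex, §2.4.4 Thm. 2.4.23] -/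
theorem mem_hodgeGroupC_prod_subtorus_quotient_iff (hV : IsLatticeSubspace V) (hVc : IsComplexSubspace Φ V)
    (hW : IsLatticeSubspace W) (hWc : IsComplexSubspace Φ W) (hc : IsCompl V W)
    {N : SpecialLinearGroup (Fin (subRank V) ⊕ QuotIndex V) ℂ} :
    N ∈ hodgeGroupC (prodPeriod (subtorusPeriod Φ V hV hVc) (quotientTorusPeriod Φ V hV hVc)) ↔
      ∃ g ∈ hodgeGroupC Φ, ∃ (gY : SpecialLinearGroup (Fin (subRank V)) ℂ) (gQ : SpecialLinearGroup (QuotIndex V) ℂ),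
        N = blockDiagC _ _ (gY, gQ) ∧
        g.1 * (subtorusMatrix V).map (Int.cast : ℤ → ℂ) = (subtorusMatrix V).map (Int.cast : ℤ → ℂ) * gY.1 ∧
        (quotientTorusMatrix V).map (Int.cast : ℤ → ℂ) * g.1 = gQ.1 * (quotientTorusMatrix V).map (Int.cast : ℤ → ℂ) := by
  constructor
  · intro hN
    obtain ⟨NY, -, NQ, -, rfl⟩ := exists_eq_blockDiagC_of_mem_hodgeGroupC_prod _ _ hN
    obtain ⟨g, hg, hY, hQ⟩ := exists_mem_hodgeGroupC_of_blockDiagC_mem_subtorus_quotient Φ hV hVc hW hWc hc hN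
    exact ⟨g, hg, NY, NQ, rfl, hY, hQ⟩
  · rintro ⟨g, hg, gY, gQ, rfl, hY, hQ⟩
    exact blockDiagC_mem_hodgeGroupC_subtorus_quotient Φ hV hVc hW hWc hc hg hY hQ

/-- **The restrictions and descents of `Hg(X)(ℂ)` are compatible pairs**: if `g ι_V = ι_V g_Y` and
`Q_V g = g_{X/Y} Q_V` for `g ∈ Hg(X)(ℂ)`, then `g_Y ∈ Hg(Y)(ℂ)` and `g_{X/Y} ∈ Hg(X/Y)(ℂ)` (read off the product
group). [cite: MoonenZarhin1999LowDim, §3 (3.1)] -/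
theorem mem_hodgeGroupC_of_restrict_of_quotient (hV : IsLatticeSubspace V) (hVc : IsComplexSubspace Φ V)
    (hW : IsLatticeSubspace W) (hWc : IsComplexSubspace Φ W) (hc : IsCompl V W) {g : SpecialLinearGroup ι ℂ}
    (hg : g ∈ hodgeGroupC Φ) {gY : SpecialLinearGroup (Fin (subRank V)) ℂ} {gQ : SpecialLinearGroup (QuotIndex V) ℂ}
    (hY : g.1 * (subtorusMatrix V).map (Int.cast : ℤ → ℂ) = (subtorusMatrix V).map (Int.cast : ℤ → ℂ) * gY.1)
    (hQ : (quotientTorusMatrix V).map (Int.cast : ℤ → ℂ) * g.1 = gQ.1 * (quotientTorusMatrix V).map (Int.cast : ℤ → ℂ)) :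
    gY ∈ hodgeGroupC (subtorusPeriod Φ V hV hVc) ∧ gQ ∈ hodgeGroupC (quotientTorusPeriod Φ V hV hVc) :=
  have h := blockDiagC_mem_hodgeGroupC_subtorus_quotient Φ hV hVc hW hWc hc hg hY hQ
  ⟨fst_mem_hodgeGroupC_of_blockDiagC_mem _ _ h, snd_mem_hodgeGroupC_of_blockDiagC_mem _ _ h⟩

end Complementary

/-! ## §3 The polarised case (`Z = Y^⊥`) -/

section Polarised

variable {ι : Type*} [Fintype ι] [DecidableEq ι] {E : Type*} [NormedAddCommGroup E] [NormedSpace ℂ E]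
  (Φ : (ι → ℝ) ≃L[ℝ] E) (V : Submodule ℝ (ι → ℝ)) {η : E [⋀^Fin 2]→L[ℝ] ℝ}

/-- **For an abelian subvariety `Y` of a polarised torus `(X, η)`: `diag(g_Y, g_{X/Y}) ∈ Hg(Y × X/Y)(ℂ)` for every
`g ∈ Hg(X)(ℂ)`** (complement `Y^⊥` by Poincaré). [cite: MoonenZarhin1999LowDim, §3 (3.1) and (0.2)(4)]
[cite: Lange2023AbelianVarietiesComplex, §2.4.4 Thm. 2.4.23, Thm. 2.4.25] -/
theorem IsRiemannForm.blockDiagC_mem_hodgeGroupC_subtorus_quotient (hη : IsRiemannForm Φ η)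
    (hV : IsLatticeSubspace V) (hVc : IsComplexSubspace Φ V) {g : SpecialLinearGroup ι ℂ} (hg : g ∈ hodgeGroupC Φ)
    {gY : SpecialLinearGroup (Fin (subRank V)) ℂ} {gQ : SpecialLinearGroup (QuotIndex V) ℂ}
    (hY : g.1 * (subtorusMatrix V).map (Int.cast : ℤ → ℂ) = (subtorusMatrix V).map (Int.cast : ℤ → ℂ) * gY.1)
    (hQ : (quotientTorusMatrix V).map (Int.cast : ℤ → ℂ) * g.1 = gQ.1 * (quotientTorusMatrix V).map (Int.cast : ℤ → ℂ)) :
    blockDiagC _ _ (gY, gQ) ∈ hodgeGroupC (prodPeriod (subtorusPeriod Φ V hV hVc) (quotientTorusPeriod Φ V hV hVc)) :=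
  ComplexTorus.blockDiagC_mem_hodgeGroupC_subtorus_quotient Φ hV hVc (poincare_reducibility Φ hη hV hVc).1
    (poincare_reducibility Φ hη hV hVc).2.1 (poincare_reducibility Φ hη hV hVc).2.2 hg hY hQ

/-- **For an abelian subvariety of a polarised torus: `Hg(Y × X/Y)(ℂ) = {diag(g_Y, g_{X/Y}) : g ∈ Hg(X)(ℂ)}`.**
[cite: MoonenZarhin1999LowDim, §3 (3.1) and (0.2)(4)] [cite: Lange2023AbelianVarietiesComplex, §2.4.4 Thm. 2.4.23, Thm. 2.4.25] -/
theorem IsRiemannForm.mem_hodgeGroupC_prod_subtorus_quotient_iff (hη : IsRiemannForm Φ η)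
    (hV : IsLatticeSubspace V) (hVc : IsComplexSubspace Φ V) {N : SpecialLinearGroup (Fin (subRank V) ⊕ QuotIndex V) ℂ} :
    N ∈ hodgeGroupC (prodPeriod (subtorusPeriod Φ V hV hVc) (quotientTorusPeriod Φ V hV hVc)) ↔
      ∃ g ∈ hodgeGroupC Φ, ∃ (gY : SpecialLinearGroup (Fin (subRank V)) ℂ) (gQ : SpecialLinearGroup (QuotIndex V) ℂ),
        N = blockDiagC _ _ (gY, gQ) ∧
        g.1 * (subtorusMatrix V).map (Int.cast : ℤ → ℂ) = (subtorusMatrix V).map (Int.cast : ℤ → ℂ) * gY.1 ∧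
        (quotientTorusMatrix V).map (Int.cast : ℤ → ℂ) * g.1 = gQ.1 * (quotientTorusMatrix V).map (Int.cast : ℤ → ℂ) :=
  ComplexTorus.mem_hodgeGroupC_prod_subtorus_quotient_iff Φ hV hVc (poincare_reducibility Φ hη hV hVc).1
    (poincare_reducibility Φ hη hV hVc).2.1 (poincare_reducibility Φ hη hV hVc).2.2

/-- **Compatible pairs for a polarised torus**: the restriction `g_Y` and the descent `g_{X/Y}` of `g ∈ Hg(X)(ℂ)` lie
in `Hg(Y)(ℂ)` and `Hg(X/Y)(ℂ)`. [cite: MoonenZarhin1999LowDim, §3 (3.1)] -/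
theorem IsRiemannForm.mem_hodgeGroupC_of_restrict_of_quotient (hη : IsRiemannForm Φ η)
    (hV : IsLatticeSubspace V) (hVc : IsComplexSubspace Φ V) {g : SpecialLinearGroup ι ℂ} (hg : g ∈ hodgeGroupC Φ)
    {gY : SpecialLinearGroup (Fin (subRank V)) ℂ} {gQ : SpecialLinearGroup (QuotIndex V) ℂ}
    (hY : g.1 * (subtorusMatrix V).map (Int.cast : ℤ → ℂ) = (subtorusMatrix V).map (Int.cast : ℤ → ℂ) * gY.1)
    (hQ : (quotientTorusMatrix V).map (Int.cast : ℤ → ℂ) * g.1 = gQ.1 * (quotientTorusMatrix V).map (Int.cast : ℤ → ℂ)) :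
    gY ∈ hodgeGroupC (subtorusPeriod Φ V hV hVc) ∧ gQ ∈ hodgeGroupC (quotientTorusPeriod Φ V hV hVc) :=
  ComplexTorus.mem_hodgeGroupC_of_restrict_of_quotient Φ hV hVc (poincare_reducibility Φ hη hV hVc).1
    (poincare_reducibility Φ hη hV hVc).2.1 (poincare_reducibility Φ hη hV hVc).2.2 hg hY hQ

end Polarised

end ComplexTorus

end Literature.Geometry.Kaehler

end
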